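import Mathlib
import HarnessLib
import Summits.HubbardSuperconductivity.HubbardSuperconductivity.Theorems.ComplexGFFStiffnessHypALocalTwoPointFreeEnergyPackage
import Summits.HubbardSuperconductivity.HubbardSuperconductivity.Theorems.ComplexGFFStiffnessHypALocalTwoPointFreeEnergySeed

/-!
# Crux `HypALocalTwoPoint`, line `gnv` — the three clauses of `FreeEnergyBounds` for ONE `d = 4` package at
# EVERY height, from the slots: the choice of `ρ, ε, ρ_𝒦` after the sizes (census F1 residual, step 3a/3)

Route `route-HubbardSuperconductivity-ComplexGFFStiffness`, crux item stmt-HubbardSuperconductivity-19155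
(`HypALocalTwoPoint`), registered stub `stub_twoPointGivenZ` (⇐ `FreeEnergyBounds` ⇐ route children
`F4Statement 4`, `H1bcStatement 4`, `F1Residual`).  For a `d = 4` package `P : PackageData 4` with `r, T₀ > 0`,
`L^4 C_{8.7} A_𝒫'/A ≤ 1/6` and `σ(r) ≤ 7/16` (the per-`L` side conditions of `gnv_of_torusFRD`), given `N`-free
sizes for the nine `q`-slots and the state slot at every height, we CHOOSE — after the sizes, as in [ABKM19]
Lemma 12.6 — the seed radius `ρ = min(1/64, T₀/c_q)`, the tube width `ε` (so that `3ε ≤ min(r, ρ)`, `c_q ε ≤ 1/6`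
and the smallness (12.54)–(12.56) hold at `η = 1/2`, `κ = 7/8`) and the perturbation radius
`ρ_𝒦 = ε/(512 e^{3/8} e^{𝔥_0} A)`, and obtain from `exists_freeEnergyConsts_of_slots` (+ the `d = 4` link
`pertZ_eq_Z0_mul_exp_of_seed`) the three clauses of `FreeEnergyBounds` with ONE constant `C` for ALL heights `N`;
increments `U` with both ends in the `ρ_𝒦`-ball are run with the size `min(δ, 2ρ_𝒦)`:

* **`freeEnergy_allN_of_slots`**.

All proved, no `sorry`.  Honest scope: a rung route (stiffness of a complex Gaussian gradient field), conditional
on the slots (hypotheses); nothing about superconductivity in the Hubbard model.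

## References
* S. Adams, S. Buchholz, R. Kotecký, S. Müller, arXiv:1910.13564, Thm 2.2, Ch. 4 (4.4)–(4.12), Lemma 12.6,
  proof of Thm 12.1 [AdamsBuchholzKoteckyMuller2019].
-/

noncomputable section

-- `Summit.<Summit>.<Problem>`: single-conjunct summit, the duplicate component is mandated (D-0017).
set_option linter.dupNamespace false

namespace Summit.HubbardSuperconductivity.HubbardSuperconductivity.Theorems.ComplexGFF

open scoped BigOperators ComplexConjugate
open Real Set Finset MeasureTheory
open Literature.MathematicalPhysics.StatisticalMechanics.ComplexGradientGFF4 (D S)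
open Literature.MathematicalPhysics.StatisticalMechanics.GradientRG
open Literature.MathematicalPhysics.QuantumFieldTheory
open Literature.Dynamics.Hyperbolic

/-! ## Calculus of the admissibility bounds -/

/-- The derivative bounds of an increment `U = (K + U) − K` between two points of the `ρ`-ball: size `2ρ`. -/
theorem iteratedFDeriv_incr_le {r₀ : ℕ} {ρ : ℝ} {K U : (Fin 4 → ℝ) → ℂ} (hK : ContDiff ℝ r₀ K) (hU : ContDiff ℝ r₀ U)
    (hKb : ∀ s, s ≤ r₀ → ∀ z : Fin 4 → ℝ, ‖iteratedFDeriv ℝ s K z‖ ≤ ρ * Real.exp ((∑ i, z i ^ 2) / 4))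
    (hKUb : ∀ s, s ≤ r₀ → ∀ z : Fin 4 → ℝ,
      ‖iteratedFDeriv ℝ s (fun z => K z + U z) z‖ ≤ ρ * Real.exp ((∑ i, z i ^ 2) / 4)) :
    ∀ s, s ≤ r₀ → ∀ z : Fin 4 → ℝ, ‖iteratedFDeriv ℝ s U z‖ ≤ 2 * ρ * Real.exp ((∑ i, z i ^ 2) / 4) := by
  intro s hs z
  have hs' : (s : WithTop ℕ∞) ≤ (r₀ : WithTop ℕ∞) := by exact_mod_cast hs
  have e : U = (fun z => K z + U z) - K := by funext z; simp
  have hd : iteratedFDeriv ℝ s U z = iteratedFDeriv ℝ s (fun z => K z + U z) z - iteratedFDeriv ℝ s K z := by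
    conv_lhs => rw [e]
    rw [iteratedFDeriv_sub_apply ((hK.add hU).of_le hs').contDiffAt (hK.of_le hs').contDiffAt]
  rw [hd]
  calc _ ≤ ‖iteratedFDeriv ℝ s (fun z => K z + U z) z‖ + ‖iteratedFDeriv ℝ s K z‖ := norm_sub_le _ _
    _ ≤ ρ * Real.exp ((∑ i, z i ^ 2) / 4) + ρ * Real.exp ((∑ i, z i ^ 2) / 4) := add_le_add (hKUb s hs z) (hKb s hs z)
    _ = _ := by ring

/-- Two derivative bounds combine to the bound by the minimum of the sizes. -/
theorem iteratedFDeriv_le_min {r₀ : ℕ} {a b : ℝ} {U : (Fin 4 → ℝ) → ℂ}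
    (ha : ∀ s, s ≤ r₀ → ∀ z : Fin 4 → ℝ, ‖iteratedFDeriv ℝ s U z‖ ≤ a * Real.exp ((∑ i, z i ^ 2) / 4))
    (hb : ∀ s, s ≤ r₀ → ∀ z : Fin 4 → ℝ, ‖iteratedFDeriv ℝ s U z‖ ≤ b * Real.exp ((∑ i, z i ^ 2) / 4)) :
    ∀ s, s ≤ r₀ → ∀ z : Fin 4 → ℝ, ‖iteratedFDeriv ℝ s U z‖ ≤ min a b * Real.exp ((∑ i, z i ^ 2) / 4) := by
  intro s hs z
  rcases min_choice a b with h | h <;> rw [h]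
  · exact ha s hs z
  · exact hb s hs z

/-! ## The three clauses at every height, one constant -/

set_option maxHeartbeats 3200000 in
/-- **The three clauses of `FreeEnergyBounds` for one `d = 4` package at every height** (module docstring):
after the `N`-free sizes of the slots, choose `ρ, ε, ρ_𝒦` ([ABKM19] proof of Thm 12.1 / Lemma 12.6 smallness)
and get ONE `ρ_𝒦 > 0` and ONE `C ≥ 0` with, at every height `N` (`M = L^N`): a free energy `f` and a constant
`c` such that `pertZ M K = c·exp(f K)` on the `ι`-admissible `ρ_𝒦`-ball, `‖f(K+U) − f K‖ ≤ C|Λ|δ` and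
`‖f(K+U+V) − f(K+U) − f(K+V) + f K‖ ≤ C|Λ|δ₁δ₂`. [cite: AdamsBuchholzKoteckyMuller2019, Thm 2.2 / Lemma 12.6] -/
theorem freeEnergy_allN_of_slots (P : PackageData 4) [Fact (0 < P.h)] [Fact (0 < P.L)]
    (hr : 0 < P.r) (hT₀ : 0 < P.T₀) (hp4 : 4 * P.pT ≤ 2 ^ (4 + 2))
    (hβ : (P.L : ℝ) ^ 4 * (pi2BoundConst 4 (((2 * P.R + 2 : ℕ) : ℝ) + ((4 / 2 + 1 : ℕ) : ℝ)) * (P.A𝒫' * P.A⁻¹)) ≤ 1 / 6)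
    (hσ : sigmaABKM 4 P.L P.R P.A P.A𝒫' P.r ≤ 7 / 16)
    {aT bT lT aTT bTT lTT lT' φT φTT σ₂ : ℝ} (haT : 0 ≤ aT) (hbT : 0 ≤ bT) (hlT : 0 ≤ lT) (haTT : 0 ≤ aTT)
    (hbTT : 0 ≤ bTT) (hlTT : 0 ≤ lTT) (hlT' : 0 ≤ lT') (hφT : 0 ≤ φT) (hφTT : 0 ≤ φTT) (hσ₂ : 0 ≤ σ₂)
    (hslots : ∀ (N M : ℕ) [NeZero M] (Q : PackageAt P N M),
        F4a P Q aT ∧ F4b P Q bT ∧ F4l P Q lT ∧ F4a2 P Q aTT ∧ F4b2 P Q bTT ∧ F4l2 P Q lTT ∧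
          F4l' P Q lT' ∧ F4Φ2 P Q φT ∧ F4Φ22 P Q φTT)
    (hstate : ∀ (N M : ℕ) [NeZero M] (Q : PackageAt P N M), H1σ2 P Q σ₂) :
    ∃ ρK C : ℝ, 0 < ρK ∧ 0 ≤ C ∧ ∀ (N M : ℕ) [NeZero M] (Q : PackageAt P N M),
      ∃ f : ((Fin 4 → ℝ) → ℂ) → ℂ, ∃ c : ℂ,
        (∀ K, IsIotaAdmissible P.r₀ ρK K → pertZ M K = c * Complex.exp (f K)) ∧
        (∀ (K U : (Fin 4 → ℝ) → ℂ) (δ : ℝ), IsIotaAdmissible P.r₀ ρK K →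
            IsIotaAdmissible P.r₀ ρK (fun z => K z + U z) → 0 ≤ δ → IsIotaAdmissible P.r₀ δ U →
            ‖f (fun z => K z + U z) - f K‖ ≤ C * (Fintype.card (Fin 4 → ZMod M) : ℝ) * δ) ∧
        (∀ (K U V : (Fin 4 → ℝ) → ℂ) (u₁ u₂ : ℝ), IsIotaAdmissible P.r₀ ρK K →
            IsIotaAdmissible P.r₀ ρK (fun z => K z + U z) → IsIotaAdmissible P.r₀ ρK (fun z => K z + V z) →
            IsIotaAdmissible P.r₀ ρK (fun z => K z + U z + V z) → 0 ≤ u₁ → 0 ≤ u₂ →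
            IsIotaAdmissible P.r₀ u₁ U → IsIotaAdmissible P.r₀ u₂ V →
            ‖f (fun z => K z + U z + V z) - f (fun z => K z + U z) - f (fun z => K z + V z) + f K‖
              ≤ C * (Fintype.card (Fin 4 → ZMod M) : ℝ) * u₁ * u₂) := by
  have hA1 := P.hA1
  have hA : 0 < P.A := by linarith
  have hA𝒫1 : 1 ≤ P.A𝒫' := by
    rw [← P.hA𝒫']
    exact one_le_weightIntConstRho P.hθbar P.hθ0 P.hθ
      (traceConst_nonneg 4 P.Mord P.R P.hlam.le (derivSum_nonneg 4 P.n _))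
  have hA𝒫0 : 0 ≤ P.A𝒫' := by linarith
  -- the constant `c_q` of the tuning map and `𝔥₀`
  set 𝔥₀ : ℝ := fieldWt P.h (P.L : ℝ) 4 0 with h𝔥₀
  have h𝔥₀pos : 0 < 𝔥₀ := fieldWt_pos P.hh (by exact_mod_cast (Fact.out : 0 < P.L)) 4 0
  set cq : ℝ := 2 * ((4 : ℕ) : ℝ) ^ 2 / (((P.L ^ (4 * 0) : ℕ) : ℝ) * (fieldWt P.h (P.L : ℝ) 4 0 / (P.L : ℝ) ^ 0) ^ 2)
    with hcq
  have hcq' : cq = 32 / 𝔥₀ ^ 2 := by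
    rw [hcq, h𝔥₀]; norm_num
  have hcqpos : 0 < cq := by rw [hcq']; positivity
  -- `ρ`
  set ρ : ℝ := min (1 / 64) (P.T₀ / cq) with hρdef
  have hρpos : 0 < ρ := lt_min (by norm_num) (div_pos hT₀ hcqpos)
  have hρ64 : ρ ≤ 1 / 64 := min_le_left _ _
  have hqT₀ : cq * ρ ≤ P.T₀ := by
    calc cq * ρ ≤ cq * (P.T₀ / cq) := mul_le_mul_of_nonneg_left (min_le_right _ _) hcqpos.le
      _ = P.T₀ := by field_simp
  -- the sizes at the `h₀`-level entering the smallness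
  set a₀ : ℝ := aT * cq with ha₀
  set b₀ : ℝ := bT * cq with hb₀
  set l₀ : ℝ := lT * cq with hl₀
  have ha₀0 : 0 ≤ a₀ := mul_nonneg haT hcqpos.le
  have hb₀0 : 0 ≤ b₀ := mul_nonneg hbT hcqpos.le
  have hl₀0 : 0 ≤ l₀ := mul_nonneg hlT hcqpos.le
  set Ssum : ℝ := 2 * l₀ + (3 / 4 * b₀ + a₀ * (1 / 2 + 1 / 6 + 2 * ρ * b₀)) + 1 with hSsum
  have hSpos : 0 < Ssum := by
    have : 0 ≤ a₀ * (1 / 2 + 1 / 6 + 2 * ρ * b₀) := mul_nonneg ha₀0 (by positivity)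
    rw [hSsum]; linarith
  -- `ε`
  set ε : ℝ := min (min P.r ρ / 3) (min (1 / (6 * cq)) (1 / (16 * Ssum))) with hεdef
  have hεpos : 0 < ε := lt_min (by positivity) (lt_min (by positivity) (by positivity))
  have hε3 : ε ≤ min P.r ρ / 3 := min_le_left _ _
  have hεr : 3 * ε ≤ P.r := by linarith [min_le_left P.r ρ]
  have hερ : 3 * ε ≤ ρ := by linarith [min_le_right P.r ρ]
  have hε1 : ε < 1 := by linarith [P.hr]
  have hqε : cq * ε ≤ 1 / 6 := by
    calc cq * ε ≤ cq * (1 / (6 * cq)) :=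
          mul_le_mul_of_nonneg_left ((min_le_right _ _).trans (min_le_left _ _)) hcqpos.le
      _ = 1 / 6 := by field_simp
  have hεS : ε ≤ 1 / (16 * Ssum) := (min_le_right _ _).trans (min_le_right _ _)
  have hεS' : Ssum * ε ≤ 1 / 16 := by
    calc Ssum * ε ≤ Ssum * (1 / (16 * Ssum)) := mul_le_mul_of_nonneg_left hεS hSpos.le
      _ = 1 / 16 := by field_simp
  -- `ρ_𝒦`
  set ρK : ℝ := ε / (512 * Real.exp (3 / 8) * Real.exp 𝔥₀ * P.A) with hρK
  have hρKpos : 0 < ρK := by positivity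
  have hexp0 : Real.exp (fieldWt P.h (P.L : ℝ) 4 0 / (P.L : ℝ) ^ 0) = Real.exp 𝔥₀ := by
    rw [pow_zero, div_one]
  have hA' : P.A ≠ 0 := hA.ne'
  have hE𝔥 : Real.exp 𝔥₀ ≠ 0 := (Real.exp_pos _).ne'
  have he38 : 0 < Real.exp (3 / 8) := Real.exp_pos _
  have hE38 : Real.exp (3 / 8) ≠ 0 := he38.ne'
  have he14 : Real.exp (1 / 4) ≤ Real.exp (3 / 8) := Real.exp_le_exp.2 (by norm_num)
  have he140 : 0 < Real.exp (1 / 4) := Real.exp_pos _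
  have hX : ρK * Real.exp 𝔥₀ * P.A * Real.exp (3 / 8) = ε / 512 := by
    rw [hρK]; field_simp
  have hXnn : 0 ≤ ρK * Real.exp 𝔥₀ * P.A := by positivity
  have h𝒦small : (Real.exp (1 / 4) + 2 * Real.exp (3 / 8)) *
      (ρK * Real.exp (fieldWt P.h (P.L : ℝ) 4 0 / (P.L : ℝ) ^ 0)) * P.A ≤ 1 / 2 := by
    rw [hexp0]
    calc (Real.exp (1 / 4) + 2 * Real.exp (3 / 8)) * (ρK * Real.exp 𝔥₀) * P.A
          = (Real.exp (1 / 4) + 2 * Real.exp (3 / 8)) * (ρK * Real.exp 𝔥₀ * P.A) := by ring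
      _ ≤ (3 * Real.exp (3 / 8)) * (ρK * Real.exp 𝔥₀ * P.A) :=
          mul_le_mul_of_nonneg_right (by linarith) hXnn
      _ = 3 * (ρK * Real.exp 𝔥₀ * P.A * Real.exp (3 / 8)) := by ring
      _ = 3 * (ε / 512) := by rw [hX]
      _ ≤ 1 / 2 := by linarith
  have h𝒦ε : Real.exp (1 / 4) * (ρK * Real.exp (fieldWt P.h (P.L : ℝ) 4 0 / (P.L : ℝ) ^ 0)) * P.A ≤ ε := by
    rw [hexp0]
    calc Real.exp (1 / 4) * (ρK * Real.exp 𝔥₀) * P.A = Real.exp (1 / 4) * (ρK * Real.exp 𝔥₀ * P.A) := by ring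
      _ ≤ Real.exp (3 / 8) * (ρK * Real.exp 𝔥₀ * P.A) := mul_le_mul_of_nonneg_right he14 hXnn
      _ = ρK * Real.exp 𝔥₀ * P.A * Real.exp (3 / 8) := by ring
      _ = ε / 512 := hX
      _ ≤ ε := by linarith
  have h16 : 16 * Real.exp (3 / 8) * (ρK * Real.exp (fieldWt P.h (P.L : ℝ) 4 0 / (P.L : ℝ) ^ 0)) * P.A ≤ 1 / 16 := by
    rw [hexp0]
    calc 16 * Real.exp (3 / 8) * (ρK * Real.exp 𝔥₀) * P.A = 16 * (ρK * Real.exp 𝔥₀ * P.A * Real.exp (3 / 8)) := by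
          ring
      _ = 16 * (ε / 512) := by rw [hX]
      _ ≤ 1 / 16 := by linarith
  -- the smallness (12.54)–(12.56)
  have hsmallF : max (16 * Real.exp (3 / 8) * (ρK * Real.exp (fieldWt P.h (P.L : ℝ) 4 0 / (P.L : ℝ) ^ 0)) * P.A)
      (max (lT * cq * ε / (1 / 2 : ℝ))
        ((3 / 4 * (bT * cq) + aT * cq * ((1 / 2 : ℝ) + ((P.L : ℝ) ^ 4 *
            (pi2BoundConst 4 (((2 * P.R + 2 : ℕ) : ℝ) + ((4 / 2 + 1 : ℕ) : ℝ)) * (P.A𝒫' * P.A⁻¹))) + 2 * ρ * (bT * cq))) * ε))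
      ≤ (1 - (7 / 8 : ℝ)) / 2 := by
    have e16 : (1 - (7 / 8 : ℝ)) / 2 = 1 / 16 := by norm_num
    rw [e16]
    refine max_le h16 (max_le ?_ ?_)
    · rw [← hl₀]
      calc l₀ * ε / (1 / 2 : ℝ) = (2 * l₀) * ε := by ring
        _ ≤ Ssum * ε := by
            refine mul_le_mul_of_nonneg_right ?_ hεpos.le
            have : 0 ≤ a₀ * (1 / 2 + 1 / 6 + 2 * ρ * b₀) := mul_nonneg ha₀0 (by positivity)
            rw [hSsum]; linarith
        _ ≤ 1 / 16 := hεS'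
    · rw [← hb₀, ← ha₀]
      calc (3 / 4 * b₀ + a₀ * (1 / 2 + (P.L : ℝ) ^ 4 *
              (pi2BoundConst 4 (((2 * P.R + 2 : ℕ) : ℝ) + ((4 / 2 + 1 : ℕ) : ℝ)) * (P.A𝒫' * P.A⁻¹)) + 2 * ρ * b₀)) * ε
            ≤ (3 / 4 * b₀ + a₀ * (1 / 2 + 1 / 6 + 2 * ρ * b₀)) * ε := by
              refine mul_le_mul_of_nonneg_right ?_ hεpos.le
              have : a₀ * (1 / 2 + (P.L : ℝ) ^ 4 *
                  (pi2BoundConst 4 (((2 * P.R + 2 : ℕ) : ℝ) + ((4 / 2 + 1 : ℕ) : ℝ)) * (P.A𝒫' * P.A⁻¹)) + 2 * ρ * b₀)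
                  ≤ a₀ * (1 / 2 + 1 / 6 + 2 * ρ * b₀) := mul_le_mul_of_nonneg_left (by linarith) ha₀0
              linarith
        _ ≤ Ssum * ε := by
            refine mul_le_mul_of_nonneg_right ?_ hεpos.le
            rw [hSsum]; linarith
        _ ≤ 1 / 16 := hεS'
  -- contraction regime at `η = 1/2`, `κ = 7/8`
  have hκ₁ : (3 / 4 : ℝ) * ((1 / 2 : ℝ) + (P.L : ℝ) ^ 4 * (pi2BoundConst 4 (((2 * P.R + 2 : ℕ) : ℝ) + ((4 / 2 + 1 : ℕ) : ℝ)) *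
      (P.A𝒫' * P.A⁻¹))) ≤ 7 / 8 := by linarith
  have hκ₂ : sigmaABKM 4 P.L P.R P.A P.A𝒫' P.r ≤ (7 / 8 : ℝ) * (1 / 2) := by linarith
  -- the package theorem with `N`-free constants
  obtain ⟨C₂, C₃, key⟩ := exists_freeEnergyConsts_of_slots P hp4 hr haT hbT hlT haTT hbTT hlTT hlT' hφT hφTT hσ₂
    hslots hstate (η := 1 / 2) (κ := 7 / 8) (ε := ε) (ρ := ρ) (by norm_num) (by norm_num) hκ₁ hκ₂ (by norm_num)
    hεpos.le hεr hερ hρ64 hqT₀ hqε (ρ𝒦 := ρK) h𝒦small h𝒦ε hsmallF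
  -- increments: both ends in the `ρ_𝒦`-ball ⇒ run the clauses with `min δ (2ρ_𝒦)`
  have hpert2 : ∀ u₁ : ℝ, 0 ≤ u₁ → u₁ ≤ 2 * ρK →
      Real.exp (1 / 4) * ((ρK + u₁) * Real.exp (fieldWt P.h (P.L : ℝ) 4 0 / (P.L : ℝ) ^ 0)) * P.A ≤ 1 / 2 := by
    intro u₁ hu₁0 hu₁
    rw [hexp0]
    have h3 : (ρK + u₁) ≤ 3 * ρK := by linarith
    have hE0 : 0 ≤ Real.exp 𝔥₀ := (Real.exp_pos _).le
    calc Real.exp (1 / 4) * ((ρK + u₁) * Real.exp 𝔥₀) * P.A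
          ≤ Real.exp (3 / 8) * ((3 * ρK) * Real.exp 𝔥₀) * P.A := by
            refine mul_le_mul_of_nonneg_right (mul_le_mul he14 (mul_le_mul_of_nonneg_right h3 hE0)
              (mul_nonneg (by linarith) hE0) he38.le) hA.le
      _ = 3 * (ρK * Real.exp 𝔥₀ * P.A * Real.exp (3 / 8)) := by ring
      _ = 3 * (ε / 512) := by rw [hX]
      _ ≤ 1 / 2 := by linarith
  have hpert3 : ∀ u₁ u₂ : ℝ, 0 ≤ u₁ → 0 ≤ u₂ → u₁ ≤ 2 * ρK → u₂ ≤ 2 * ρK →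
      (Real.exp (1 / 4) + 16 * Real.exp (3 / 8) * (2 * ρ) + 16 * Real.exp (3 / 8) * (2 * ρ)
        + 256 * Real.exp (1 / 4) * (2 * ρ) * (2 * ρ)) *
          ((ρK + u₁ + u₂) * Real.exp (fieldWt P.h (P.L : ℝ) 4 0 / (P.L : ℝ) ^ 0)) * P.A ≤ 1 / 2 := by
    intro u₁ u₂ hu₁0 hu₂0 hu₁ hu₂
    rw [hexp0]
    have h5 : (ρK + u₁ + u₂) ≤ 5 * ρK := by linarith
    have hE0 : 0 ≤ Real.exp 𝔥₀ := (Real.exp_pos _).le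
    have h2ρ : 2 * ρ ≤ 1 / 32 := by linarith
    have h2ρ0 : 0 ≤ 2 * ρ := by linarith
    have t1 : 16 * Real.exp (3 / 8) * (2 * ρ) ≤ Real.exp (3 / 8) / 2 := by nlinarith
    have t2 : 256 * Real.exp (1 / 4) * (2 * ρ) * (2 * ρ) ≤ Real.exp (1 / 4) / 4 := by
      have hsq : (2 * ρ) * (2 * ρ) ≤ (1 / 32) * (1 / 32) := mul_le_mul h2ρ h2ρ h2ρ0 (by norm_num)
      nlinarith
    have hΓ : Real.exp (1 / 4) + 16 * Real.exp (3 / 8) * (2 * ρ) + 16 * Real.exp (3 / 8) * (2 * ρ)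
        + 256 * Real.exp (1 / 4) * (2 * ρ) * (2 * ρ) ≤ 3 * Real.exp (3 / 8) := by linarith
    calc (Real.exp (1 / 4) + 16 * Real.exp (3 / 8) * (2 * ρ) + 16 * Real.exp (3 / 8) * (2 * ρ)
          + 256 * Real.exp (1 / 4) * (2 * ρ) * (2 * ρ)) * ((ρK + u₁ + u₂) * Real.exp 𝔥₀) * P.A
          ≤ (3 * Real.exp (3 / 8)) * ((5 * ρK) * Real.exp 𝔥₀) * P.A := by
            refine mul_le_mul_of_nonneg_right (mul_le_mul hΓ (mul_le_mul_of_nonneg_right h5 hE0)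
              (mul_nonneg (by linarith) hE0) (by positivity)) hA.le
      _ = 15 * (ρK * Real.exp 𝔥₀ * P.A * Real.exp (3 / 8)) := by ring
      _ = 15 * (ε / 512) := by rw [hX]
      _ ≤ 1 / 2 := by linarith
  refine ⟨ρK, max (max C₂ C₃) 0, hρKpos, le_max_right _ _, fun N M _ Q => ?_⟩
  obtain ⟨fE, h0, h2, h3⟩ := key N M Q
  have hcard : (0 : ℝ) ≤ (Fintype.card (Fin 4 → ZMod M) : ℝ) := Nat.cast_nonneg _
  refine ⟨fE, ((∫ φ : (Fin 4 → ZMod M) → ℝ, Real.exp (-(S 0 φ)) : ℝ) : ℂ), ?_, ?_, ?_⟩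
  · -- clause 1: the representation (d = 4 link)
    intro K hK
    obtain ⟨hKd, hKb, hKι⟩ := hK
    obtain ⟨x₀, hι, hx₀ρ, hI, hfE⟩ := h0 K hKd hKb hKι
    rw [hfE]
    exact pertZ_eq_Z0_mul_exp_of_seed (N := N) Q.hallA P.hT₀ P.hA1 hA𝒫0 P.hA𝒫A (η := 1 / 2) (ε := ε) (ρ := ρ)
      (by norm_num) (by norm_num) hεpos.le hε1 hρpos.le hqT₀ hKd.continuous hι hx₀ρ hI
  · -- clause 2: first differences
    intro K U δ hK hKU hδ hU
    obtain ⟨hKd, hKb, hKι⟩ := hK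
    obtain ⟨hKUd, hKUb, hKUι⟩ := hKU
    obtain ⟨hUd, hUb, hUι⟩ := hU
    have hUb2 := iteratedFDeriv_incr_le hKd hUd hKb hKUb
    have hUmin := iteratedFDeriv_le_min hUb hUb2
    have hu0 : 0 ≤ min δ (2 * ρK) := le_min hδ (by positivity)
    have h := h2 K U (min δ (2 * ρK)) hKd hKb hKι hUd hKUb hKUι hUmin hu0 (hpert2 _ hu0 (min_le_right _ _))
    calc _ ≤ C₂ * (Fintype.card (Fin 4 → ZMod M) : ℝ) * min δ (2 * ρK) := h
      _ ≤ max (max C₂ C₃) 0 * (Fintype.card (Fin 4 → ZMod M) : ℝ) * min δ (2 * ρK) := by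
          have : C₂ ≤ max (max C₂ C₃) 0 := (le_max_left _ _).trans (le_max_left _ _)
          have h' : 0 ≤ (Fintype.card (Fin 4 → ZMod M) : ℝ) * min δ (2 * ρK) := mul_nonneg hcard hu0
          nlinarith
      _ ≤ max (max C₂ C₃) 0 * (Fintype.card (Fin 4 → ZMod M) : ℝ) * δ :=
          mul_le_mul_of_nonneg_left (min_le_left _ _) (mul_nonneg (le_max_right _ _) hcard)
  · -- clause 3: mixed second differences
    intro K U V u₁ u₂ hK hKU hKV hKUV hu₁ hu₂ hU hV
    obtain ⟨hKd, hKb, hKι⟩ := hK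
    obtain ⟨hKUd, hKUb, hKUι⟩ := hKU
    obtain ⟨hKVd, hKVb, hKVι⟩ := hKV
    obtain ⟨hKUVd, hKUVb, hKUVι⟩ := hKUV
    obtain ⟨hUd, hUb, hUι⟩ := hU
    obtain ⟨hVd, hVb, hVι⟩ := hV
    have hUb2 := iteratedFDeriv_incr_le hKd hUd hKb hKUb
    have hVb2 := iteratedFDeriv_incr_le hKd hVd hKb hKVb
    have hUmin := iteratedFDeriv_le_min hUb hUb2
    have hVmin := iteratedFDeriv_le_min hVb hVb2
    have hu0 : 0 ≤ min u₁ (2 * ρK) := le_min hu₁ (by positivity)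
    have hv0 : 0 ≤ min u₂ (2 * ρK) := le_min hu₂ (by positivity)
    have h := h3 K U V (min u₁ (2 * ρK)) (min u₂ (2 * ρK)) hKd hUd hVd hKb hKUb hKVb hKUVb hKι hKUι hKVι hKUVι
      hUmin hVmin hu0 hv0 (hpert3 _ _ hu0 hv0 (min_le_right _ _) (min_le_right _ _))
    calc _ ≤ C₃ * (Fintype.card (Fin 4 → ZMod M) : ℝ) * min u₁ (2 * ρK) * min u₂ (2 * ρK) := h
      _ ≤ max (max C₂ C₃) 0 * (Fintype.card (Fin 4 → ZMod M) : ℝ) * min u₁ (2 * ρK) * min u₂ (2 * ρK) := by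
          have : C₃ ≤ max (max C₂ C₃) 0 := (le_max_right _ _).trans (le_max_left _ _)
          have h' : 0 ≤ (Fintype.card (Fin 4 → ZMod M) : ℝ) * min u₁ (2 * ρK) * min u₂ (2 * ρK) :=
            mul_nonneg (mul_nonneg hcard hu0) hv0
          nlinarith
      _ ≤ max (max C₂ C₃) 0 * (Fintype.card (Fin 4 → ZMod M) : ℝ) * u₁ * min u₂ (2 * ρK) :=
          mul_le_mul_of_nonneg_right
            (mul_le_mul_of_nonneg_left (min_le_left _ _) (mul_nonneg (le_max_right _ _) hcard)) hv0
      _ ≤ max (max C₂ C₃) 0 * (Fintype.card (Fin 4 → ZMod M) : ℝ) * u₁ * u₂ :=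
          mul_le_mul_of_nonneg_left (min_le_left _ _)
            (mul_nonneg (mul_nonneg (le_max_right _ _) hcard) hu₁)

end Summit.HubbardSuperconductivity.HubbardSuperconductivity.Theorems.ComplexGFF

end
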